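import Summits.ValiantsHypothesis.ValiantsHypothesis.Theorems.BarrierLeverPartitionMinorsChowProductStateTables

/-!
# Route BarrierLever — Chow witnesses for partition minors (item 20172, CPM): SHIFTED INCLUSION and
# DISJOINTNESS minors — `det[[u i ∆ B ⊆ w j ∆ C]] ≠ 0 ⇒ Chow-hit`, every height, every size

Helper file (`--supports stmt-ValiantsHypothesis-20172`; cell valiant-natproofs, rung V4, 𝒟-side of
door (c); seat valiant-natproofs-prover gen 12).  Closes NO item; definition-free.

Conventions of items 19717 / 20172 / 20195: `x_a = X (Fin.castAdd h a)`, `y_c = X (Fin.natAdd h c)`,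
`E u w = Σ_{a∈u} e_{x_a} + Σ_{c∈w} e_{y_c}`; `(u, w)` is CHOW-HIT when some product of `h + h` affine
forms has `det[coeff_{E (u i) (w j)} ∏ ℓ] ≠ 0`.

One statement containing the inclusion witness (`…ChowInclusionWitness`, `B = C = ∅`), the ball
theorem (`…ChowBallRowsAffineIndependent`) and the translate class: for ANY two fixed sets
`B, C ⊆ Fin h` the `0/1` site tables `m a ε η = [ (ε ≠ [a∈B]) → (η ≠ [a∈C]) ]` have product
`∏_a m a [a∈u] [a∈w] = [ u ∆ B ⊆ w ∆ C ]`, and every table is a Chow table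
(`chow_hit_of_siteTables`, `…ChowProductStateTables`).  Hence

* `chow_hit_of_shiftedInclusionMinor` — **if `det[[u i ∆ B ⊆ w j ∆ C]]_{i,j} ≠ 0` then `(u, w)` is
  hit by a product of `h + h` affine forms** (no injectivity or size hypothesis: they are implied).
  `B = C = ∅`: the inclusion minor; `C = univ`: `w ∆ univ = wᶜ`, so
* `chow_hit_of_disjointnessMinor` — **`det[[u i ∩ w j = ∅]] ≠ 0` ⇒ Chow-hit** (DISJOINTNESS minors,
  the Kneser-type pattern; e.g. every layout whose rows and columns admit a unique system of
  pairwise disjoint representatives in the Leibniz sense);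
* rows in the Hamming ball around `B` (`u i ∈ {B} ∪ {B ∆ {a}}`): `[u i ∆ B ⊆ w j]` is the bordered
  incidence matrix `[𝟙 ; [a_i ∈ w j]]`, recovering `chow_hit_ball_of_affineIndependent` and extending it
  to PARTIAL balls (any `r ≤ h + 1` ball members, centre present or not) under the one hypothesis
  that this `r × r` incidence matrix is nonsingular.

WHAT THIS IS NOT: layouts all of whose shifted-inclusion minors vanish (e.g. the locked cores with
affinely dependent columns) are untouched; nothing on items 20172 / 20195 / 19717 themselves, on crux
stmt-ValiantsHypothesis-14610, or on `VP` versus `VNP`.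
-/

set_option linter.dupNamespace false

namespace Summit.ValiantsHypothesis.ValiantsHypothesis.Theorems.BarrierLever.ChowFactor

open Finset MvPolynomial

noncomputable section

variable {h : ℕ}

/-- The shifted-inclusion table test, with a pairing `π` on the column side:
`∏_a [ ([a∈u] = [a∈B]) ∨ ([π a ∈ w] ≠ [a ∈ C]) ] = [ ∀ a ∈ u ∆ B, (π a ∈ w ↔ a ∉ C) ]`. -/
theorem prod_shiftTable_eq (π : Equiv.Perm (Fin h)) (B C u w : Finset (Fin h)) :
    (∏ a : Fin h, (if decide (a ∈ u) = decide (a ∈ B) ∨ decide (π a ∈ w) ≠ decide (a ∈ C)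
        then (1 : ℂ) else 0)) =
      if (∀ a, a ∈ symmDiff u B → (π a ∈ w ↔ a ∉ C)) then 1 else 0 := by
  classical
  have key : ∀ a : Fin h, (decide (a ∈ u) = decide (a ∈ B) ∨ decide (π a ∈ w) ≠ decide (a ∈ C)) ↔
      (a ∈ symmDiff u B → (π a ∈ w ↔ a ∉ C)) := by
    intro a
    rw [Finset.mem_symmDiff]
    by_cases h1 : a ∈ u <;> by_cases h2 : a ∈ B <;> by_cases h3 : π a ∈ w <;> by_cases h4 : a ∈ C <;>
      simp [h1, h2, h3, h4]
  by_cases hall : ∀ a, a ∈ symmDiff u B → (π a ∈ w ↔ a ∉ C)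
  · rw [if_pos hall]
    exact Finset.prod_eq_one fun a _ => if_pos ((key a).mpr (hall a))
  · rw [if_neg hall]
    obtain ⟨a, ha⟩ := not_forall.mp hall
    exact Finset.prod_eq_zero (Finset.mem_univ a) (if_neg fun hh => ha ((key a).mp hh))

/-- Membership form of `u ∆ B ⊆ w ∆ C`. -/
theorem symmDiff_subset_symmDiff_iff (B C u w : Finset (Fin h)) :
    symmDiff u B ⊆ symmDiff w C ↔ ∀ a, a ∈ symmDiff u B → (a ∈ w ↔ a ∉ C) := by
  constructor
  · intro hs a ha
    have := hs ha
    rw [Finset.mem_symmDiff] at this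
    tauto
  · intro hall a ha
    rw [Finset.mem_symmDiff]
    have := hall a ha
    by_cases hw : a ∈ w <;> by_cases hc : a ∈ C <;> tauto

/-- **SHIFTED-INCLUSION MINORS: `det[[u i ∆ B ⊆ w j ∆ C]] ≠ 0 ⇒ Chow-hit`, every height and size.**
For any fixed `B, C ⊆ Fin h`, a layout whose shifted-inclusion matrix is nonsingular is hit by a
product of `h + h` affine forms (item 20172's conclusion for it). -/
theorem chow_hit_of_shiftedInclusionMinor {r : ℕ} (B C : Finset (Fin h)) (u w : Fin r → Finset (Fin h))
    (hdet : (Matrix.of fun i j : Fin r =>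
      if symmDiff (u i) B ⊆ symmDiff (w j) C then (1 : ℂ) else 0).det ≠ 0) :
    ∃ ℓ : Fin (h + h) → MvPolynomial (Fin (h + h)) ℂ, (∀ q, (ℓ q).totalDegree ≤ 1) ∧
      (Matrix.of fun i j : Fin r => coeff
        (∑ b ∈ u i, Finsupp.single (Fin.castAdd h b) 1 + ∑ d ∈ w j, Finsupp.single (Fin.natAdd h d) 1)
        (∏ q, ℓ q)).det ≠ 0 := by
  classical
  refine chow_hit_of_siteTables u w (Equiv.refl _)
    (fun a ε η => if ε = decide (a ∈ B) ∨ η ≠ decide (a ∈ C) then (1 : ℂ) else 0) ?_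
  have hM : (Matrix.of fun i j : Fin r => ∏ a : Fin h,
        (if decide (a ∈ u i) = decide (a ∈ B) ∨
            decide ((Equiv.refl (Fin h)) a ∈ w j) ≠ decide (a ∈ C) then (1 : ℂ) else 0)) =
      Matrix.of fun i j : Fin r => if symmDiff (u i) B ⊆ symmDiff (w j) C then (1 : ℂ) else 0 := by
    ext i j
    rw [Matrix.of_apply, Matrix.of_apply, prod_shiftTable_eq (Equiv.refl (Fin h)) B C (u i) (w j)]
    by_cases hs : symmDiff (u i) B ⊆ symmDiff (w j) C
    · rw [if_pos hs, if_pos]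
      exact fun a ha => ((symmDiff_subset_symmDiff_iff B C (u i) (w j)).mp hs) a ha
    · rw [if_neg hs, if_neg]
      exact fun hall => hs ((symmDiff_subset_symmDiff_iff B C (u i) (w j)).mpr fun a ha => hall a ha)
  rw [hM]
  exact hdet

/-- **DISJOINTNESS MINORS: `det[[u i ∩ w j = ∅]] ≠ 0 ⇒ Chow-hit`** (the case `B = ∅`, `C = univ`:
`u ⊆ (w ∆ univ) = wᶜ` iff `u` and `w` are disjoint). -/
theorem chow_hit_of_disjointnessMinor {r : ℕ} (u w : Fin r → Finset (Fin h))
    (hdet : (Matrix.of fun i j : Fin r => if Disjoint (u i) (w j) then (1 : ℂ) else 0).det ≠ 0) :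
    ∃ ℓ : Fin (h + h) → MvPolynomial (Fin (h + h)) ℂ, (∀ q, (ℓ q).totalDegree ≤ 1) ∧
      (Matrix.of fun i j : Fin r => coeff
        (∑ b ∈ u i, Finsupp.single (Fin.castAdd h b) 1 + ∑ d ∈ w j, Finsupp.single (Fin.natAdd h d) 1)
        (∏ q, ℓ q)).det ≠ 0 := by
  classical
  refine chow_hit_of_shiftedInclusionMinor ∅ Finset.univ u w ?_
  have hM : (Matrix.of fun i j : Fin r =>
        if symmDiff (u i) ∅ ⊆ symmDiff (w j) Finset.univ then (1 : ℂ) else 0) =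
      Matrix.of fun i j : Fin r => if Disjoint (u i) (w j) then (1 : ℂ) else 0 := by
    ext i j
    simp only [Matrix.of_apply]
    have hiff : symmDiff (u i) ∅ ⊆ symmDiff (w j) Finset.univ ↔ Disjoint (u i) (w j) := by
      rw [symmDiff_subset_symmDiff_iff, Finset.disjoint_left]
      constructor
      · intro hs a hau haw
        have h1 : a ∈ symmDiff (u i) ∅ := by rw [Finset.mem_symmDiff]; simp [hau]
        exact absurd (Finset.mem_univ a) (((hs a h1).mp haw))
      · intro hd a ha
        rw [Finset.mem_symmDiff] at ha
        have hau : a ∈ u i := by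
          rcases ha with ⟨h1, -⟩ | ⟨h1, -⟩
          · exact h1
          · exact absurd h1 (Finset.notMem_empty a)
        constructor
        · intro haw; exact absurd haw (hd hau)
        · intro hnu; exact absurd (Finset.mem_univ a) hnu
    by_cases hd : Disjoint (u i) (w j)
    · rw [if_pos (hiff.mpr hd), if_pos hd]
    · rw [if_neg (fun hh => hd (hiff.mp hh)), if_neg hd]
  rw [hM]
  exact hdet

/-- **BALL ROWS (any centre, partial or full) × columns with nonsingular bordered incidence.**  If
every row is at symmetric-difference distance `≤ 1` from `B`, then `[u i ∆ B ⊆ w j]` is `1` on the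
centre row and `[a ∈ w j]` on the row `B ∆ {a}`; so a nonzero determinant of THIS matrix (for the
full ball: affine independence of the columns) makes the layout Chow-hit.  This is
`chow_hit_of_shiftedInclusionMinor` with `C = ∅`, recorded under the name of the class. -/
theorem chow_hit_ball_of_incidenceMinor {r : ℕ} (B : Finset (Fin h)) (u w : Fin r → Finset (Fin h))
    (hdet : (Matrix.of fun i j : Fin r => if symmDiff (u i) B ⊆ w j then (1 : ℂ) else 0).det ≠ 0) :
    ∃ ℓ : Fin (h + h) → MvPolynomial (Fin (h + h)) ℂ, (∀ q, (ℓ q).totalDegree ≤ 1) ∧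
      (Matrix.of fun i j : Fin r => coeff
        (∑ b ∈ u i, Finsupp.single (Fin.castAdd h b) 1 + ∑ d ∈ w j, Finsupp.single (Fin.natAdd h d) 1)
        (∏ q, ℓ q)).det ≠ 0 := by
  refine chow_hit_of_shiftedInclusionMinor B ∅ u w ?_
  have hM : (Matrix.of fun i j : Fin r => if symmDiff (u i) B ⊆ symmDiff (w j) ∅ then (1 : ℂ) else 0) =
      Matrix.of fun i j : Fin r => if symmDiff (u i) B ⊆ w j then (1 : ℂ) else 0 := by
    ext i j
    have he : symmDiff (w j) ∅ = w j := by
      ext a; rw [Finset.mem_symmDiff]; simp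
    rw [Matrix.of_apply, Matrix.of_apply, he]
  rw [hM]
  exact hdet

end

end Summit.ValiantsHypothesis.ValiantsHypothesis.Theorems.BarrierLever.ChowFactor
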